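import Literature.Analysis.Complex.RectangleResidueSimplePoles
import Literature.Analysis.Complex.ZeroSumVariation
import HarnessLib

/-!
# The residue theorem on a rectangle for finitely many poles of order at most two

Trunk T-ANALYSIS support (`Literature/Analysis/Complex`), continuing
`RectangleResidueSimplePoles.lean` (`Literature.Analysis.Complex.rectBoundaryIntegral_eq_sum_of_simplePoles`,
finitely many *simple* poles). Explicit formulae with second-order kernels — Riesz / logarithmic
means `∑_{n ≤ N} a_n log(N/n) = (1/2πi)∫ F(s) N^s ds/s²`, and sums over zeros of the shape
`∑_ρ N^{ρ-s}/(ζ'(ρ)(ρ-s)²)` (Bettin–Conrey–Farmer 2013, Lemma 2 and proof of Thm. 1) — produce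
**double poles**, whose residues are derivatives. This file proves the corresponding residue theorem:

* `Literature.Analysis.Complex.rectBoundaryIntegral_eq_sum_of_doublePoles` — let `K = [a,b] × [c,d]`,
  `U ⊇ K` open, `S ⊆ K°` finite, `F` complex differentiable on `U ∖ S`, and suppose that at every
  `p ∈ S`, `F(z) = φ_p(z)/(z − p)²` on a punctured neighbourhood of `p` with `φ_p` differentiable on a
  neighbourhood of `p` (a pole of order `≤ 2`; a simple pole `ψ/(z-p)` is the case `φ_p = (z-p)ψ`,
  and a removable singularity the case `φ_p = (z-p)²ψ`). Then, in Mathlib's four-term boundary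
  convention (`Literature.Analysis.Complex.rectBoundaryIntegral`, bottom − top + i·right − i·left),
  `∮_{∂K} F = 2πi ∑_{p ∈ S} φ_p'(p)`.
* `Literature.Analysis.Complex.rectBoundaryIntegral_inv_sub_sq` — `∮_{∂K} dz/(z − p)² = 0` for `p ∈ K°`.

Proof: induction on `S`, exactly as in the simple-pole file. For `p ∈ S`,
`F − φ_p(p)/(z−p)² − φ_p'(p)/(z−p) = dslope (dslope φ_p p) p` near `p` (two removable-singularity
steps, Mathlib's `differentiableOn_dslope`), at the other poles `q` the corrected function is again
of the form `ψ/(z−q)²` with the same `ψ'(q)`, and `∮ dz/(z−p)² = 0` (the derivative of `−1/(z−p)`,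
`Literature.Analysis.Complex.rectBoundaryIntegral_deriv_eq_zero`), `∮ dz/(z−p) = 2πi`.

Textbook statement: the residue theorem (Conway, *Functions of One Complex Variable I*, V.2.2) with
the residue at a pole of order two computed as `Res_p F = (d/dz)[(z−p)² F(z)]_{z=p}` (Conway V.2.4).

## References

* J. B. Conway, *Functions of One Complex Variable I*, 2nd ed., GTM 11, Springer 1978, Ch. V §2,
  Thm. 2.2 (Residue Theorem) and Prop. 2.4 (residue at a pole of order `m`). [Conway1978]
-/

noncomputable section

open Complex Set MeasureTheory Filter intervalIntegral
open _root_.Topology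

namespace Literature.Analysis.Complex

variable {a b c d : ℝ}

/-- `∮_{∂K} dz/(z − p)² = 0` for `p` in the open rectangle `K° = (a,b) × (c,d)`: the integrand is
the derivative of `−(z − p)⁻¹`, analytic at every boundary point. [cite: Conway1978, Ch. V Prop. 2.4] -/
theorem rectBoundaryIntegral_inv_sub_sq (p : ℂ) (ha : a < p.re) (hb : p.re < b) (hc : c < p.im)
    (hd : p.im < d) :
    rectBoundaryIntegral (fun z ↦ ((z - p) ^ 2)⁻¹) a b c d = 0 := by
  have hab : a ≤ b := (ha.trans hb).le
  have hcd : c ≤ d := (hc.trans hd).le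
  set h : ℂ → ℂ := fun z ↦ -(z - p)⁻¹ with hh
  have hderiv : ∀ z : ℂ, z ≠ p → deriv h z = ((z - p) ^ 2)⁻¹ := by
    intro z hz
    have hne : z - p ≠ 0 := sub_ne_zero.2 hz
    have h1 : HasDerivAt (fun w : ℂ ↦ (w - p)⁻¹) (-(1 : ℂ) / (z - p) ^ 2) z :=
      ((hasDerivAt_id' z).sub_const p).inv hne
    have h2 : HasDerivAt h ((z - p) ^ 2)⁻¹ z := by
      have h3 := h1.neg
      rw [show -(-1 / (z - p) ^ 2) = ((z - p) ^ 2)⁻¹ by rw [neg_div, neg_neg, one_div]] at h3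
      exact h3
    exact h2.deriv
  have han : ∀ z : ℂ, z ≠ p → AnalyticAt ℂ h z := by
    intro z hz
    exact ((analyticAt_id.sub analyticAt_const).inv (sub_ne_zero.2 hz)).neg
  have hpK : p ∈ Ioo a b ×ℂ Ioo c d := by
    rw [mem_reProdIm]; exact ⟨⟨ha, hb⟩, ⟨hc, hd⟩⟩
  have hbot : ∀ x : ℝ, x ∈ Icc a b → ((x : ℂ) + c * I) ≠ p := fun x _ ↦
    ne_of_mem_Ioo_reProdIm_of_im hpK (Or.inl (by simp))
  have htop : ∀ x : ℝ, x ∈ Icc a b → ((x : ℂ) + d * I) ≠ p := fun x _ ↦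
    ne_of_mem_Ioo_reProdIm_of_im hpK (Or.inr (by simp))
  have hleft : ∀ y : ℝ, y ∈ Icc c d → ((a : ℂ) + y * I) ≠ p := fun y _ ↦
    ne_of_mem_Ioo_reProdIm_of_re hpK (Or.inl (by simp))
  have hright : ∀ y : ℝ, y ∈ Icc c d → ((b : ℂ) + y * I) ≠ p := fun y _ ↦
    ne_of_mem_Ioo_reProdIm_of_re hpK (Or.inr (by simp))
  have h0 := rectBoundaryIntegral_deriv_eq_zero (h := h) hab hcd
    (fun x hx ↦ han _ (hbot x hx)) (fun x hx ↦ han _ (htop x hx))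
    (fun y hy ↦ han _ (hleft y hy)) (fun y hy ↦ han _ (hright y hy))
  rw [← h0]
  exact rectBoundaryIntegral_congr hab hcd (fun x hx ↦ (hderiv _ (hbot x hx)).symm)
    (fun x hx ↦ (hderiv _ (htop x hx)).symm) (fun y hy ↦ (hderiv _ (hleft y hy)).symm)
    (fun y hy ↦ (hderiv _ (hright y hy)).symm)

/-- The local normal form at a pole of order `≤ 2`: if `F = φ/(z-p)²` near `p`, then
`F − φ(p)/(z−p)² − φ'(p)/(z−p) = dslope (dslope φ p) p` at every `z ≠ p` of that neighbourhood.
[cite: Conway1978, Ch. V Prop. 2.4] -/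
theorem sub_polar_eq_dslope_dslope {F φ : ℂ → ℂ} {p z : ℂ} (hz : z ≠ p)
    (hF : F z = φ z / (z - p) ^ 2) :
    F z - φ p / (z - p) ^ 2 - deriv φ p / (z - p) = dslope (dslope φ p) p z := by
  have hne : z - p ≠ 0 := sub_ne_zero.2 hz
  rw [dslope_of_ne _ hz, slope_def_field, dslope_of_ne _ hz, slope_def_field, dslope_same, hF]
  field_simp

/-- **Residue theorem on a rectangle, finitely many poles of order at most two.** Let
`K = [a,b] × [c,d]` (`a < b`, `c < d`), `U ⊇ K` open, `S ⊆ K°` a finite set, `F : ℂ → ℂ` complex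
differentiable on `U ∖ S`, and suppose that for every `p ∈ S` there are a neighbourhood `V` of `p` and
`φ` differentiable on `V` with `F(z) = φ(z)/(z − p)²` for `z ∈ V ∖ {p}` and `φ'(p) = r(p)`. Then
`∮_{∂K} F = 2πi ∑_{p ∈ S} r(p)` (four-term convention of Mathlib). The values of `F` at the points
of `S` are irrelevant. [cite: Conway1978, Ch. V Thm. 2.2 and Prop. 2.4] -/
theorem rectBoundaryIntegral_eq_sum_of_doublePoles (hab : a < b) (hcd : c < d) (S : Finset ℂ) :
    ∀ (F : ℂ → ℂ) (r : ℂ → ℂ) (U : Set ℂ), IsOpen U → Icc a b ×ℂ Icc c d ⊆ U →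
      ((S : Set ℂ) ⊆ Ioo a b ×ℂ Ioo c d) →
      DifferentiableOn ℂ F (U \ ↑S) →
      (∀ p ∈ S, ∃ φ : ℂ → ℂ, ∃ V ∈ 𝓝 p, DifferentiableOn ℂ φ V ∧ deriv φ p = r p ∧
          ∀ z ∈ V, z ≠ p → F z = φ z / (z - p) ^ 2) →
      rectBoundaryIntegral F a b c d = 2 * Real.pi * I * ∑ p ∈ S, r p := by
  classical
  induction S using Finset.induction_on with
  | empty =>
    intro F r U _ hKU _ hF _
    have hd : DifferentiableOn ℂ F (Icc a b ×ℂ Icc c d) :=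
      hF.mono (by simpa using hKU)
    rw [rectBoundaryIntegral_eq_zero_of_differentiableOn hab.le hcd.le hd]
    simp
  | insert p S' hpS' ih =>
    intro F r U hU hKU hsub hF hpole
    -- the pole `p`
    have hpK : p ∈ Ioo a b ×ℂ Ioo c d := hsub (Finset.mem_insert_self p S')
    obtain ⟨φ, V, hV, hφ, hφp, hFφ⟩ := hpole p (Finset.mem_insert_self p S')
    have hsub' : ((S' : Set ℂ) ⊆ Ioo a b ×ℂ Ioo c d) := fun q hq ↦
      hsub (Finset.mem_insert_of_mem hq)
    have hpS'c : ∀ q ∈ S', q ≠ p := fun q hq h ↦ hpS' (h ▸ hq)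
    -- the polar part at `p` and the corrected function `F₁ = F - polar part`
    set c₀ : ℂ := φ p with hc₀
    set c₁ : ℂ := deriv φ p with hc₁
    set Pp : ℂ → ℂ := fun z ↦ c₀ / (z - p) ^ 2 + c₁ / (z - p) with hPp
    set F₁ : ℂ → ℂ := fun z ↦ if z = p then deriv (dslope φ p) p else F z - Pp z with hF₁
    have hF₁_of_ne : ∀ {z : ℂ}, z ≠ p → F₁ z = F z - Pp z := fun hz ↦ by
      simp [hF₁, hz]
    have hPp_diff : ∀ {z : ℂ}, z ≠ p → DifferentiableAt ℂ Pp z := by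
      intro z hz
      have hne : z - p ≠ 0 := sub_ne_zero.2 hz
      exact ((differentiableAt_const _).div ((differentiableAt_id.sub_const p).pow 2)
        (pow_ne_zero 2 hne)).add
        ((differentiableAt_const _).div (differentiableAt_id.sub_const p) hne)
    -- `F₁ = dslope (dslope φ p) p` near `p`
    have hF₁V : ∀ z ∈ V, F₁ z = dslope (dslope φ p) p z := by
      intro z hz
      by_cases hzp : z = p
      · rw [hzp]
        simp [hF₁, dslope_same]
      · rw [hF₁_of_ne hzp]
        have := sub_polar_eq_dslope_dslope hzp (hFφ z hz hzp)
        rw [← this, hPp]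
        ring
    have hF₁p : DifferentiableAt ℂ F₁ p := by
      have h1 : DifferentiableOn ℂ (dslope φ p) V := (differentiableOn_dslope hV).2 hφ
      have h2 : DifferentiableOn ℂ (dslope (dslope φ p) p) V := (differentiableOn_dslope hV).2 h1
      have h3 : DifferentiableAt ℂ (dslope (dslope φ p) p) p := h2.differentiableAt hV
      refine h3.congr_of_eventuallyEq ?_
      filter_upwards [hV] with z hz using hF₁V z hz
    -- the open set on which `F` itself is differentiable
    have hOpen : IsOpen (U \ ↑(insert p S')) :=
      hU.sdiff (Finset.finite_toSet _).isClosed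
    have hFat : ∀ {z : ℂ}, z ∈ U → z ∉ insert p S' → DifferentiableAt ℂ F z := by
      intro z hzU hzS
      exact hF.differentiableAt (hOpen.mem_nhds ⟨hzU, by simpa using hzS⟩)
    -- differentiability of `F₁` on `U \ S'`
    have hF₁d : DifferentiableOn ℂ F₁ (U \ ↑S') := by
      intro z hz
      apply DifferentiableAt.differentiableWithinAt
      by_cases hzp : z = p
      · rw [hzp]; exact hF₁p
      · have hzS : z ∉ insert p S' := by
          simp only [Finset.mem_insert, not_or]
          exact ⟨hzp, by simpa using hz.2⟩
        have hG : DifferentiableAt ℂ (fun w ↦ F w - Pp w) z := (hFat hz.1 hzS).sub (hPp_diff hzp)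
        refine hG.congr_of_eventuallyEq ?_
        filter_upwards [isOpen_ne.mem_nhds hzp] with w hw using hF₁_of_ne hw
    -- the pole data of `F₁` at the remaining poles
    have hpole₁ : ∀ q ∈ S', ∃ ψ : ℂ → ℂ, ∃ W ∈ 𝓝 q, DifferentiableOn ℂ ψ W ∧ deriv ψ q = r q ∧
        ∀ z ∈ W, z ≠ q → F₁ z = ψ z / (z - q) ^ 2 := by
      intro q hq
      have hqp : q ≠ p := hpS'c q hq
      obtain ⟨ψ, W, hW, hψ, hψq, hFψ⟩ := hpole q (Finset.mem_insert_of_mem hq)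
      -- an open neighbourhood of `q` inside `W` avoiding `p`
      obtain ⟨W', hW'W, hW'o, hqW'⟩ := mem_nhds_iff.1 (inter_mem hW (isOpen_ne.mem_nhds hqp))
      have hW'p : ∀ z ∈ W', z ≠ p := fun z hz ↦ (hW'W hz).2
      have hW'1 : ∀ z ∈ W', z ∈ W := fun z hz ↦ (hW'W hz).1
      set ψ₁ : ℂ → ℂ := fun z ↦ ψ z - Pp z * (z - q) ^ 2 with hψ₁
      have hcorr : ∀ z ∈ W', DifferentiableAt ℂ (fun z ↦ Pp z * (z - q) ^ 2) z := fun z hz ↦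
        (hPp_diff (hW'p z hz)).mul ((differentiableAt_id.sub_const q).pow 2)
      have hψ₁d : DifferentiableOn ℂ ψ₁ W' := by
        intro z hz
        have h1 : DifferentiableAt ℂ ψ z :=
          hψ.differentiableAt (Filter.mem_of_superset (hW'o.mem_nhds hz) hW'1)
        exact (h1.sub (hcorr z hz)).differentiableWithinAt
      refine ⟨ψ₁, W', hW'o.mem_nhds hqW', hψ₁d, ?_, ?_⟩
      · -- `ψ₁'(q) = ψ'(q)` since the correction vanishes to second order at `q`
        have h1 : DifferentiableAt ℂ ψ q := hψ.differentiableAt hW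
        have h2 : HasDerivAt (fun z ↦ Pp z * (z - q) ^ 2) 0 q := by
          have hP := (hPp_diff hqp).hasDerivAt
          have hsq : HasDerivAt (fun z : ℂ ↦ (z - q) ^ 2) (((2 : ℕ) : ℂ) * (q - q) ^ (2 - 1) * 1) q :=
            ((hasDerivAt_id' q).sub_const q).fun_pow 2
          have := hP.fun_mul hsq
          simpa using this
        have h3 : deriv ψ₁ q = deriv ψ q - 0 := by
          rw [hψ₁]
          rw [deriv_fun_sub h1 h2.differentiableAt, h2.deriv]
        rw [h3, sub_zero, hψq]
      · intro z hz hzq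
        have hzp : z ≠ p := hW'p z hz
        have hne : (z - q) ^ 2 ≠ 0 := pow_ne_zero 2 (sub_ne_zero.2 hzq)
        rw [hF₁_of_ne hzp, hFψ z (hW'1 z hz) hzq, hψ₁]
        field_simp
    -- induction hypothesis
    have hI := ih F₁ r U hU hKU hsub' hF₁d hpole₁
    -- continuity of the two pieces on `∂K`
    have hbdy : ∀ {z : ℂ}, z ∈ Icc a b ×ℂ Icc c d → (z.im = c ∨ z.im = d) ∨ (z.re = a ∨ z.re = b) →
        ContinuousAt F₁ z ∧ ContinuousAt Pp z ∧ F z = F₁ z + Pp z := by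
      intro z hzK hz
      have hzp : z ≠ p := by
        rcases hz with h | h
        · exact ne_of_mem_Ioo_reProdIm_of_im hpK h
        · exact ne_of_mem_Ioo_reProdIm_of_re hpK h
      have hzS' : z ∉ (S' : Set ℂ) := by
        intro h
        have h' := hsub' h
        rw [mem_reProdIm] at h'
        rcases hz with (h1 | h1) | (h1 | h1)
        · linarith [h'.2.1]
        · linarith [h'.2.2]
        · linarith [h'.1.1]
        · linarith [h'.1.2]
      have hzU : z ∈ U := hKU hzK
      refine ⟨?_, (hPp_diff hzp).continuousAt, ?_⟩
      · exact (hF₁d.differentiableAt ((hU.sdiff (Finset.finite_toSet _).isClosed).mem_nhds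
          ⟨hzU, hzS'⟩)).continuousAt
      · rw [hF₁_of_ne hzp]
        ring
    have memK_h : ∀ {x : ℝ} (y : ℝ), x ∈ Icc a b → (y = c ∨ y = d) →
        (x : ℂ) + y * I ∈ Icc a b ×ℂ Icc c d := by
      intro x y hx hy
      rw [mem_reProdIm]
      refine ⟨by simpa using hx, ?_⟩
      rcases hy with rfl | rfl <;> simp [hcd.le]
    have memK_v : ∀ (x : ℝ) {y : ℝ}, (x = a ∨ x = b) → y ∈ Icc c d →
        (x : ℂ) + y * I ∈ Icc a b ×ℂ Icc c d := by
      intro x y hx hy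
      rw [mem_reProdIm]
      refine ⟨?_, by simpa using hy⟩
      rcases hx with rfl | rfl <;> simp [hab.le]
    have him : ∀ (x y : ℝ), ((x : ℂ) + y * I).im = y := fun x y ↦ by simp
    have hre : ∀ (x y : ℝ), ((x : ℂ) + y * I).re = x := fun x y ↦ by simp
    -- the polar part integrates to `2πi c₁`
    have hpolar : rectBoundaryIntegral Pp a b c d = 2 * Real.pi * I * c₁ := by
      have hcont2 : ∀ {z : ℂ}, z ≠ p → ContinuousAt (fun w ↦ c₀ * ((w - p) ^ 2)⁻¹) z :=
        fun hz ↦ continuousAt_const.mul (((continuousAt_id.sub continuousAt_const).pow 2).inv₀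
          (pow_ne_zero 2 (sub_ne_zero.2 hz)))
      have hcont1 : ∀ {z : ℂ}, z ≠ p → ContinuousAt (fun w ↦ c₁ * (w - p)⁻¹) z :=
        fun hz ↦ continuousAt_const.mul ((continuousAt_id.sub continuousAt_const).inv₀
          (sub_ne_zero.2 hz))
      have hne_h : ∀ {x : ℝ} (y : ℝ), x ∈ Icc a b → (y = c ∨ y = d) → ((x : ℂ) + y * I) ≠ p := by
        intro x y hx hy
        refine ne_of_mem_Ioo_reProdIm_of_im hpK ?_
        rcases hy with rfl | rfl
        · exact Or.inl (him x _)
        · exact Or.inr (him x _)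
      have hne_v : ∀ (x : ℝ) {y : ℝ}, (x = a ∨ x = b) → y ∈ Icc c d → ((x : ℂ) + y * I) ≠ p := by
        intro x y hx hy
        refine ne_of_mem_Ioo_reProdIm_of_re hpK ?_
        rcases hx with rfl | rfl
        · exact Or.inl (hre _ y)
        · exact Or.inr (hre _ y)
      have hsplit : rectBoundaryIntegral Pp a b c d =
          rectBoundaryIntegral (fun w ↦ c₀ * ((w - p) ^ 2)⁻¹ + c₁ * (w - p)⁻¹) a b c d := by
        refine rectBoundaryIntegral_congr hab.le hcd.le (fun x hx ↦ ?_) (fun x hx ↦ ?_)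
          (fun y hy ↦ ?_) (fun y hy ↦ ?_) <;> simp only [hPp, div_eq_mul_inv]
      rw [hsplit, rectBoundaryIntegral_add hab.le hcd.le
        (fun x hx ↦ hcont2 (hne_h c hx (Or.inl rfl))) (fun x hx ↦ hcont2 (hne_h d hx (Or.inr rfl)))
        (fun y hy ↦ hcont2 (hne_v a (Or.inl rfl) hy)) (fun y hy ↦ hcont2 (hne_v b (Or.inr rfl) hy))
        (fun x hx ↦ hcont1 (hne_h c hx (Or.inl rfl))) (fun x hx ↦ hcont1 (hne_h d hx (Or.inr rfl)))
        (fun y hy ↦ hcont1 (hne_v a (Or.inl rfl) hy)) (fun y hy ↦ hcont1 (hne_v b (Or.inr rfl) hy)),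
        rectBoundaryIntegral_const_mul, rectBoundaryIntegral_inv_sub_sq p hpK.1.1 hpK.1.2 hpK.2.1
          hpK.2.2, rectBoundaryIntegral_const_mul_inv_sub c₁ p hpK.1.1 hpK.1.2 hpK.2.1 hpK.2.2]
      ring
    -- assemble
    have hcongr : rectBoundaryIntegral F a b c d =
        rectBoundaryIntegral (fun z ↦ F₁ z + Pp z) a b c d := by
      refine rectBoundaryIntegral_congr hab.le hcd.le (fun x hx ↦ ?_) (fun x hx ↦ ?_)
        (fun y hy ↦ ?_) (fun y hy ↦ ?_)
      · exact (hbdy (memK_h c hx (Or.inl rfl)) (Or.inl (Or.inl (him x c)))).2.2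
      · exact (hbdy (memK_h d hx (Or.inr rfl)) (Or.inl (Or.inr (him x d)))).2.2
      · exact (hbdy (memK_v a (Or.inl rfl) hy) (Or.inr (Or.inl (hre a y)))).2.2
      · exact (hbdy (memK_v b (Or.inr rfl) hy) (Or.inr (Or.inr (hre b y)))).2.2
    have hadd : rectBoundaryIntegral (fun z ↦ F₁ z + Pp z) a b c d =
        rectBoundaryIntegral F₁ a b c d + rectBoundaryIntegral Pp a b c d :=
      rectBoundaryIntegral_add hab.le hcd.le
        (fun x hx ↦ (hbdy (memK_h c hx (Or.inl rfl)) (Or.inl (Or.inl (him x c)))).1)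
        (fun x hx ↦ (hbdy (memK_h d hx (Or.inr rfl)) (Or.inl (Or.inr (him x d)))).1)
        (fun y hy ↦ (hbdy (memK_v a (Or.inl rfl) hy) (Or.inr (Or.inl (hre a y)))).1)
        (fun y hy ↦ (hbdy (memK_v b (Or.inr rfl) hy) (Or.inr (Or.inr (hre b y)))).1)
        (fun x hx ↦ (hbdy (memK_h c hx (Or.inl rfl)) (Or.inl (Or.inl (him x c)))).2.1)
        (fun x hx ↦ (hbdy (memK_h d hx (Or.inr rfl)) (Or.inl (Or.inr (him x d)))).2.1)
        (fun y hy ↦ (hbdy (memK_v a (Or.inl rfl) hy) (Or.inr (Or.inl (hre a y)))).2.1)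
        (fun y hy ↦ (hbdy (memK_v b (Or.inr rfl) hy) (Or.inr (Or.inr (hre b y)))).2.1)
    rw [hcongr, hadd, hI, hpolar, Finset.sum_insert hpS', ← hφp]
    ring

/-- The simple-pole normal form is a special case: if `F = ψ/(z−p)` near `p` then `F = φ/(z−p)²`
with `φ = (z−p)ψ` and `φ'(p) = ψ(p)`. Recorded as the conversion of pole data used to mix simple and
double poles in `rectBoundaryIntegral_eq_sum_of_doublePoles`. [cite: Conway1978, Ch. V Prop. 2.4] -/
theorem doublePole_data_of_simplePole {F ψ : ℂ → ℂ} {p : ℂ} {V : Set ℂ} (hV : V ∈ 𝓝 p)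
    (hψ : DifferentiableOn ℂ ψ V) (hF : ∀ z ∈ V, z ≠ p → F z = ψ z / (z - p)) :
    ∃ φ : ℂ → ℂ, ∃ W ∈ 𝓝 p, DifferentiableOn ℂ φ W ∧ deriv φ p = ψ p ∧
      ∀ z ∈ W, z ≠ p → F z = φ z / (z - p) ^ 2 := by
  obtain ⟨W, hWV, hWo, hpW⟩ := mem_nhds_iff.1 hV
  refine ⟨fun z ↦ (z - p) * ψ z, W, hWo.mem_nhds hpW, ?_, ?_, ?_⟩
  · intro z hz
    have h1 : DifferentiableAt ℂ ψ z :=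
      hψ.differentiableAt (Filter.mem_of_superset (hWo.mem_nhds hz) hWV)
    exact ((differentiableAt_id.sub_const p).mul h1).differentiableWithinAt
  · have h1 : DifferentiableAt ℂ ψ p := hψ.differentiableAt hV
    have h2 : HasDerivAt (fun z ↦ (z - p) * ψ z) ((1 : ℂ) * ψ p + (p - p) * deriv ψ p) p :=
      ((hasDerivAt_id p).sub_const p).mul h1.hasDerivAt
    rw [h2.deriv]
    simp
  · intro z hz hzp
    have hne : z - p ≠ 0 := sub_ne_zero.2 hzp
    rw [hF z (hWV hz) hzp]
    field_simp

end Literature.Analysis.Complex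

end
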